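import Summits.AtomisticToContinuum.FouriersLaw.Theorems.OddSectorIrreversibilitySubBallisticWindowCoboundaryCeiling
import Summits.AtomisticToContinuum.FouriersLaw.Theorems.OddSectorIrreversibilityCorrectorTheoryDetFlow
import Literature.Analysis.FunctionSpaces.SmoothParametricIntegral

/-!
# `SubBallisticWindow` (stmt-AtomisticToContinuum-14070), line `Sketch`: the time-averaged coboundary corrector, part 1

Support file for crux `Summit.AtomisticToContinuum.FouriersLaw.Theses.OddSectorIrreversibility.SubBallisticWindow`
(E2 of route OddSectorIrreversibility): calculus of the TIME-AVERAGED COBOUNDARY CORRECTOR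
`G̃_τ(x) = ∫₀^τ (τ - s) J_B(Φ_s x) ds = ∫₀^τ Q_B(t)(x) dt` (`Q_B(t)(x) = ∫_{(0,t]} J_B(Φ_s x) ds`, `Φ = detFlow` the
closed Hamiltonian flow), used in part 2 (`…SubBallisticWindowCorrectorEquivalence.lean`) to prove that E2 is
EQUIVALENT to the registered stub `stub_correctorFamily` of the line. §1 one-dimensional calculus (tent identity,
moving-window derivative); §2 `contDiff_intervalIntegral_comp_detFlow`: `x ↦ ∫ₐᵇ F(σ, Φ_σ x) dσ` is `C^∞` (joint
smoothness of the two-sided closed flow by Lang's theorem, as in `CorrectorTheoryDetFlow.contDiff_detFlow`, then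
`Literature.Analysis.FunctionSpaces.contDiff_parametric_intervalIntegral`); §3 the window in time (clamped primitive,
continuity, joint measurability) and Jensen + Tonelli for its time average (`timeAverageJensenTonelli`, the
registered crux-vocabulary form). Part 2 computes `{H, G̃_τ} = Q_B(τ) - τ J_B` and builds the corrector.
No statement of the route is asserted here.
-/

noncomputable section

namespace Summit.AtomisticToContinuum.FouriersLaw.Theorems.SubBallisticWindow.TimeAveragedCorrector

open MeasureTheory Filter Topology Set
open scoped NNReal ENNReal ContDiff
open Literature.MathematicalPhysics.KineticTheory.HeatConduction
open Summit.AtomisticToContinuum.FouriersLaw.Theorems.ClosedConeSensitivity.Negative.ZeroFrictionDictionary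
open Summit.AtomisticToContinuum.FouriersLaw.Theorems.OddSectorWitness

/-! ## §1 One-dimensional calculus: primitives, the tent identity, the moving-window derivative -/

/-- FTC-1 for a continuous integrand: `d/dt ∫ₐᵗ g = g(t)`. [folklore] -/
theorem hasDerivAt_primitive {g : ℝ → ℝ} (hg : Continuous g) (a t : ℝ) :
    HasDerivAt (fun u => ∫ s in a..u, g s) (g t) t :=
  intervalIntegral.integral_hasDerivAt_right (hg.intervalIntegrable _ _)
    (hg.stronglyMeasurableAtFilter volume (𝓝 t)) hg.continuousAt

/-- **Tent identity** (integration by parts): `∫₀^τ (∫₀ᵗ g) dt = ∫₀^τ (τ - s) g(s) ds`, `g` continuous. [folklore] -/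
theorem integral_primitive_eq_tent {g : ℝ → ℝ} (hg : Continuous g) (τ : ℝ) :
    ∫ t in (0:ℝ)..τ, (∫ s in (0:ℝ)..t, g s) = ∫ s in (0:ℝ)..τ, (τ - s) * g s := by
  have hv : ∀ t ∈ uIcc (0:ℝ) τ, HasDerivAt (fun u => ∫ s in (0:ℝ)..u, g s) (g t) t :=
    fun t _ => hasDerivAt_primitive hg 0 t
  have hu : ∀ t ∈ uIcc (0:ℝ) τ, HasDerivAt (fun u : ℝ => u - τ) 1 t :=
    fun t _ => (hasDerivAt_id t).sub_const τ
  have h : ∫ u in (0:ℝ)..τ, (u - τ) * g u =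
      (τ - τ) * (∫ s in (0:ℝ)..τ, g s) - (0 - τ) * (∫ s in (0:ℝ)..0, g s) -
        ∫ u in (0:ℝ)..τ, 1 * ∫ s in (0:ℝ)..u, g s :=
    intervalIntegral.integral_mul_deriv_eq_deriv_mul hu hv (continuous_const.intervalIntegrable _ _)
      (hg.intervalIntegrable _ _)
  rw [sub_self, zero_mul, intervalIntegral.integral_same, mul_zero, sub_zero, zero_sub] at h
  -- `h : ∫ (u - τ) g = -∫ 1 · (∫₀ᵘ g)`
  calc ∫ t in (0:ℝ)..τ, (∫ s in (0:ℝ)..t, g s)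
      = ∫ t in (0:ℝ)..τ, 1 * ∫ s in (0:ℝ)..t, g s := by simp
    _ = -∫ u in (0:ℝ)..τ, (u - τ) * g u := by rw [h]; ring
    _ = ∫ s in (0:ℝ)..τ, (τ - s) * g s := by
        rw [← intervalIntegral.integral_neg]
        refine intervalIntegral.integral_congr fun s _ => ?_
        ring

/-- **Moving-window derivative.** For continuous `g` and `τ`, the function
`F(r) = ∫_r^{τ+r} (τ + r - u) g(u) du` has derivative `(∫₀^τ g) - τ g(0)` at `r = 0`. [folklore] -/
theorem hasDerivAt_movingTent {g : ℝ → ℝ} (hg : Continuous g) (τ : ℝ) :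
    HasDerivAt (fun r => ∫ u in r..(τ + r), (τ + r - u) * g u)
      ((∫ u in (0:ℝ)..τ, g u) - τ * g 0) 0 := by
  -- primitives `A(s) = ∫₀ˢ g`, `B(s) = ∫₀ˢ u g(u) du`
  set A : ℝ → ℝ := fun s => ∫ u in (0:ℝ)..s, g u with hA
  set B : ℝ → ℝ := fun s => ∫ u in (0:ℝ)..s, u * g u with hB
  have hug : Continuous fun u => u * g u := continuous_id.mul hg
  have hAd : ∀ s, HasDerivAt A (g s) s := fun s => hasDerivAt_primitive hg 0 s
  have hBd : ∀ s, HasDerivAt B (s * g s) s := fun s => hasDerivAt_primitive hug 0 s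
  -- closed form of `F`
  have hF : ∀ r, ∫ u in r..(τ + r), (τ + r - u) * g u =
      (τ + r) * (A (τ + r) - A r) - (B (τ + r) - B r) := by
    intro r
    have h1 : ∫ u in r..(τ + r), (τ + r - u) * g u =
        (τ + r) * (∫ u in r..(τ + r), g u) - ∫ u in r..(τ + r), u * g u := by
      have hi1 : IntervalIntegrable (fun u => (τ + r) * g u) volume r (τ + r) :=
        (continuous_const.mul hg).intervalIntegrable _ _
      rw [← intervalIntegral.integral_const_mul, ← intervalIntegral.integral_sub hi1
        (hug.intervalIntegrable _ _)]
      refine intervalIntegral.integral_congr fun u _ => ?_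
      ring
    rw [h1, hA, hB, intervalIntegral.integral_interval_sub_left (hg.intervalIntegrable _ _)
      (hg.intervalIntegrable _ _), intervalIntegral.integral_interval_sub_left
      (hug.intervalIntegrable _ _) (hug.intervalIntegrable _ _)]
  have hshift : ∀ r, HasDerivAt (fun r : ℝ => τ + r) 1 r := fun r => (hasDerivAt_id r).const_add τ
  have hAτ : HasDerivAt (fun r => A (τ + r)) (g (τ + 0) * 1) 0 := (hAd (τ + 0)).comp (0:ℝ) (hshift 0)
  have hBτ : HasDerivAt (fun r => B (τ + r)) ((τ + 0) * g (τ + 0) * 1) 0 := (hBd (τ + 0)).comp (0:ℝ) (hshift 0)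
  have hder : HasDerivAt (fun r => (τ + r) * (A (τ + r) - A r) - (B (τ + r) - B r))
      (1 * (A (τ + 0) - A 0) + (τ + 0) * (g (τ + 0) * 1 - g 0) - ((τ + 0) * g (τ + 0) * 1 - 0 * g 0)) 0 :=
    (((hshift 0).mul (hAτ.sub (hAd 0))).sub (hBτ.sub (hBd 0)))
  have hA0 : A 0 = 0 := by simp [hA]
  rw [show (fun r => ∫ u in r..(τ + r), (τ + r - u) * g u) = _ from funext hF]
  convert hder using 1
  rw [hA0, add_zero]
  ring


/-! ## §2 Joint smoothness of the closed flow and smooth parametric integrals along it -/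

section Flow

variable {ω₂ lam β : ℝ} (hω : 0 < ω₂) (hl : 0 ≤ lam) (hβ : 0 ≤ β)
include hω hl hβ

/-- **Smooth dependence on the initial condition of time integrals along the closed flow.** For a smooth
`F : ℝ × PhaseSpace N → ℝ` and `0 ≤ a, b`, the parametric integral `x ↦ ∫ₐᵇ F(σ, Φ_σ x) dσ` is `C^∞`.
Route: the two-sided family `Ψ x s = Φ_s x` (`s ≥ 0`), `Θ Φ_{-s} Θ x` (`s ≤ 0`) consists of integral curves of
the smooth Hamiltonian field, hence is JOINTLY smooth in `(x, s)` by Lang's theorem on flows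
(`Literature.Analysis.ODE.contDiffOn_flow_of_hasDerivAt`, exactly as in `CorrectorTheoryDetFlow.contDiff_detFlow`);
then differentiate under the integral sign (`Literature.Analysis.FunctionSpaces.contDiff_parametric_intervalIntegral`).
[cite: Lang1995, Ch. IV §1, Thm. 1.16] -/
theorem contDiff_intervalIntegral_comp_detFlow (N : ℕ) {F : ℝ × PhaseSpace N → ℝ} (hF : ContDiff ℝ ∞ F)
    {a b : ℝ} (ha : 0 ≤ a) (hb : 0 ≤ b) :
    ContDiff ℝ ∞ fun x : PhaseSpace N => ∫ σ in a..b, F (σ, detFlow ω₂ lam β N σ x) := by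
  set Y := (pinnedChain ω₂ lam β 0).drift N with hY
  set Φ := fun s y => detFlow ω₂ lam β N s y with hΦ
  set Θ : PhaseSpace N →L[ℝ] PhaseSpace N :=
    (ContinuousLinearMap.fst ℝ (Fin N → ℝ) (Fin N → ℝ)).prod
      (-(ContinuousLinearMap.snd ℝ (Fin N → ℝ) (Fin N → ℝ))) with hΘ
  have hΘa : ∀ y : PhaseSpace N, Θ y = (y.1, -y.2) := fun y => rfl
  have hΘΘ : ∀ y : PhaseSpace N, Θ (Θ y) = y := fun y => by rw [hΘa, hΘa]; simp
  have hYΘ : ∀ z, Y (Θ z) = -Θ (Y z) := fun z => by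
    rw [hY, OddSectorIrreversibility.Corrector.drift_zero_friction, hΘa,
      OddSectorIrreversibility.Corrector.hamField_flip, hΘa]
    ext i <;> simp
  have hYs : ContDiff ℝ ∞ Y := pinnedChain_contDiff_drift ω₂ lam β 0 N
  have hΦ0 : ∀ y, Φ 0 y = y := fun y => detFlow_of_nonpos (ω₂ := ω₂) (lam := lam) (β := β) N le_rfl y
  -- the two-sided family of integral curves
  set Ψ : PhaseSpace N → ℝ → PhaseSpace N := fun x s => if 0 ≤ s then Φ s x else Θ (Φ (-s) (Θ x)) with hΨ
  have hΨpos : ∀ x {s : ℝ}, 0 ≤ s → Ψ x s = Φ s x := fun x s hs => by simp only [hΨ, if_pos hs]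
  have hΨneg : ∀ x {s : ℝ}, s ≤ 0 → Ψ x s = Θ (Φ (-s) (Θ x)) := fun x s hs => by
    rcases hs.eq_or_lt with h | h
    · subst h; simp only [hΨ, le_refl, if_true, neg_zero, hΦ0, hΘΘ]
    · simp only [hΨ, if_neg (not_le.2 h)]
  have h0 : ∀ x ∈ (univ : Set (PhaseSpace N)), Ψ x 0 = x := fun x _ => by rw [hΨpos x le_rfl, hΦ0]
  have hd' : ∀ x s, HasDerivAt (Ψ x) (Y (Ψ x s)) s := by
    intro x s
    rcases lt_trichotomy s 0 with hs | hs | hs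
    · -- `s < 0`: the flipped reversed flow
      have hg : HasDerivAt (fun r => Φ r (Θ x)) (Y (Φ (-s) (Θ x))) (-s) :=
        OddSectorIrreversibility.Corrector.hasDerivAt_detFlow hω hl hβ N (Θ x) (by linarith)
      have hcomp : HasDerivAt (fun r => Φ (-r) (Θ x)) ((-1 : ℝ) • Y (Φ (-s) (Θ x))) s := by
        have := hg.scomp s (hasDerivAt_neg s)
        exact this
      have hΘd := Θ.hasFDerivAt.comp_hasDerivAt s hcomp
      have hval : Θ ((-1 : ℝ) • Y (Φ (-s) (Θ x))) = Y (Ψ x s) := by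
        rw [hΨneg x hs.le, hYΘ, map_smul]; simp
      rw [hval] at hΘd
      refine hΘd.congr_of_eventuallyEq ?_
      filter_upwards [Iio_mem_nhds hs] with r hr
      exact hΨneg x (le_of_lt hr)
    · -- `s = 0`: glue the one-sided derivatives
      subst hs
      have hR : HasDerivWithinAt (Ψ x) (Y x) (Ici 0) 0 := by
        have h := OddSectorIrreversibility.Corrector.hasDerivWithinAt_detFlow hω hl hβ N x le_rfl
        rw [show detFlow ω₂ lam β N 0 x = x from hΦ0 x] at h
        exact h.congr (fun r hr => hΨpos x hr) (by rw [hΨpos x le_rfl])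
      have hL : HasDerivWithinAt (Ψ x) (Y x) (Iic 0) 0 := by
        have hg : HasDerivWithinAt (fun r => Φ r (Θ x)) (Y (Φ 0 (Θ x))) (Ici 0) 0 :=
          OddSectorIrreversibility.Corrector.hasDerivWithinAt_detFlow hω hl hβ N (Θ x) le_rfl
        have hneg : HasDerivWithinAt (fun r : ℝ => -r) (-1 : ℝ) (Iic 0) 0 := (hasDerivWithinAt_neg 0 _)
        have hmaps : MapsTo (fun r : ℝ => -r) (Iic (0 : ℝ)) (Ici 0) := fun r hr => by
          simp only [mem_Iic] at hr; simp only [mem_Ici]; linarith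
        have hcomp : HasDerivWithinAt (fun r => Φ (-r) (Θ x)) ((-1 : ℝ) • Y (Φ 0 (Θ x))) (Iic 0) 0 :=
          hg.scomp_of_eq (0 : ℝ) hneg hmaps (by simp)
        have hΘd := Θ.hasFDerivAt.comp_hasDerivWithinAt (0 : ℝ) hcomp
        have hval : Θ ((-1 : ℝ) • Y (Φ 0 (Θ x))) = Y x := by
          rw [hΦ0, hYΘ, map_smul]; simp [hΘΘ]
        rw [hval] at hΘd
        refine hΘd.congr (fun r hr => hΨneg x hr) ?_
        rw [hΨneg x le_rfl]
        rfl
      have hval0 : Ψ x 0 = x := h0 x (mem_univ x)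
      have hu := hL.union hR
      rw [Iic_union_Ici, hasDerivWithinAt_univ] at hu
      rwa [hval0]
    · -- `s > 0`: the forward flow
      refine (OddSectorIrreversibility.Corrector.hasDerivAt_detFlow hω hl hβ N x hs).congr_of_eventuallyEq ?_
        |>.congr_deriv ?_
      · filter_upwards [Ioi_mem_nhds hs] with r hr
        exact hΨpos x (le_of_lt hr)
      · rw [hΨpos x hs.le]
  -- Lang's theorem on every time slab, hence global joint smoothness
  have hLang : ∀ T' : ℝ, ContDiffOn ℝ ∞ (fun p : PhaseSpace N × ℝ => Ψ p.1 p.2) (univ ×ˢ Ioo (-T') T') := by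
    intro T'
    have hd : ∀ x ∈ (univ : Set (PhaseSpace N)), ∀ s ∈ Ioo (-T') T', HasDerivAt (Ψ x) (Y (Ψ x s)) s :=
      fun x _ s _ => hd' x s
    have hUm : ∀ x ∈ (univ : Set (PhaseSpace N)), ∀ s ∈ Ioo (-T') T', Ψ x s ∈ (univ : Set (PhaseSpace N)) :=
      fun _ _ _ _ => mem_univ _
    exact Literature.Analysis.ODE.contDiffOn_flow_of_hasDerivAt (n := (⊤ : ℕ∞)) isOpen_univ
      hYs.contDiffOn (by exact_mod_cast le_top) isOpen_univ h0 hd hUm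
  have hΨs : ContDiff ℝ ∞ (fun p : PhaseSpace N × ℝ => Ψ p.1 p.2) := by
    rw [contDiff_iff_contDiffAt]
    rintro ⟨x, s⟩
    have hmem : (x, s) ∈ (univ : Set (PhaseSpace N)) ×ˢ Ioo (-(|s| + 1)) (|s| + 1) :=
      ⟨mem_univ _, by constructor <;> cases abs_cases s <;> linarith⟩
    exact (hLang (|s| + 1)).contDiffAt ((isOpen_univ.prod isOpen_Ioo).mem_nhds hmem)
  -- the smooth integrand `(σ, x) ↦ F (σ, Ψ x σ)` and its parametric integral
  have hH : ContDiff ℝ ∞ (fun p : ℝ × PhaseSpace N => F (p.1, Ψ p.2 p.1)) :=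
    hF.comp (contDiff_fst.prodMk (hΨs.comp (contDiff_snd.prodMk contDiff_fst)))
  have hI := Literature.Analysis.FunctionSpaces.contDiff_parametric_intervalIntegral hH a b
  -- on `[a, b] ⊆ [0, ∞)` the two-sided family is the flow
  have heq : (fun x : PhaseSpace N => ∫ σ in a..b, F (σ, detFlow ω₂ lam β N σ x)) =
      fun x : PhaseSpace N => ∫ σ in a..b, F (σ, Ψ x σ) := by
    funext x
    refine intervalIntegral.integral_congr fun σ hσ => ?_
    have hσ0 : 0 ≤ σ := by
      rcases le_total a b with hab | hab
      · rw [uIcc_of_le hab] at hσ; exact ha.trans hσ.1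
      · rw [uIcc_of_ge hab] at hσ; exact hb.trans hσ.1
    simp only [hΨpos x hσ0, hΦ]
  rw [heq]
  exact hI


/-! ## §3 The window as a function of time: clamped primitive, continuity, joint measurability, Tonelli -/

omit hω hl hβ in
/-- The window `t ↦ Q_B(t)(x) = ∫_{(0,t]} J_B(Φ_s x) ds` is the clamped primitive `∫₀^{max t 0} J_B(Φ_s x) ds`.
[folklore] -/
theorem window_eq_intervalIntegral (γ : ℝ) (N k₁ k₂ : ℕ) (t : ℝ) (x : PhaseSpace N) :
    window ω₂ lam β γ N k₁ k₂ t x =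
      ∫ s in (0:ℝ)..max t 0, blockCurrent ω₂ lam β γ N k₁ k₂ (detFlow ω₂ lam β N s x) := by
  unfold window
  rcases le_or_gt t 0 with ht | ht
  · rw [max_eq_right ht, intervalIntegral.integral_same, Ioc_eq_empty (not_lt.2 ht)]
    simp
  · rw [max_eq_left ht.le, intervalIntegral.integral_of_le ht.le]

/-- `t ↦ Q_B(t)(x)` is continuous. [folklore] -/
theorem continuous_window_time (γ : ℝ) (N k₁ k₂ : ℕ) (x : PhaseSpace N) :
    Continuous fun t => window ω₂ lam β γ N k₁ k₂ t x := by
  have hg : Continuous fun s => blockCurrent ω₂ lam β γ N k₁ k₂ (detFlow ω₂ lam β N s x) :=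
    (continuous_blockCurrent N γ k₁ k₂).comp (continuous_detFlow_time hω hl hβ N x)
  have hprim : Continuous fun u => ∫ s in (0:ℝ)..u, blockCurrent ω₂ lam β γ N k₁ k₂ (detFlow ω₂ lam β N s x) :=
    intervalIntegral.continuous_primitive (fun _ _ => hg.intervalIntegrable _ _) 0
  have heq : (fun t => window ω₂ lam β γ N k₁ k₂ t x) =
      fun t => ∫ s in (0:ℝ)..max t 0, blockCurrent ω₂ lam β γ N k₁ k₂ (detFlow ω₂ lam β N s x) :=
    funext fun t => window_eq_intervalIntegral γ N k₁ k₂ t x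
  rw [heq]
  exact hprim.comp (continuous_id.max continuous_const)

/-- `(t, x) ↦ Q_B(t)(x)` is jointly measurable. [folklore] -/
theorem measurable_window_uncurry (γ : ℝ) (N k₁ k₂ : ℕ) :
    Measurable fun p : ℝ × PhaseSpace N => window ω₂ lam β γ N k₁ k₂ p.1 p.2 :=
  measurable_uncurry_of_continuous_of_measurable (u := fun t x => window ω₂ lam β γ N k₁ k₂ t x)
    (fun x => continuous_window_time hω hl hβ γ N k₁ k₂ x) fun t => measurable_window hω hl hβ N γ k₁ k₂ t

/-- On `[0, τ]` the time integral of the window is the tent integral of the transported current: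
`∫₀^τ Q_B(t)(x) dt = ∫₀^τ (τ - s) J_B(Φ_s x) ds`. [folklore] -/
theorem intervalIntegral_window_eq_tent (γ : ℝ) (N k₁ k₂ : ℕ) {τ : ℝ} (hτ : 0 ≤ τ) (x : PhaseSpace N) :
    ∫ t in (0:ℝ)..τ, window ω₂ lam β γ N k₁ k₂ t x =
      ∫ s in (0:ℝ)..τ, (τ - s) * blockCurrent ω₂ lam β γ N k₁ k₂ (detFlow ω₂ lam β N s x) := by
  have hg : Continuous fun s => blockCurrent ω₂ lam β γ N k₁ k₂ (detFlow ω₂ lam β N s x) :=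
    (continuous_blockCurrent N γ k₁ k₂).comp (continuous_detFlow_time hω hl hβ N x)
  rw [← integral_primitive_eq_tent hg τ]
  refine intervalIntegral.integral_congr fun t ht => ?_
  have ht0 : 0 ≤ t := by rw [uIcc_of_le hτ] at ht; exact ht.1
  simp only [window_eq_intervalIntegral γ N k₁ k₂ t x, max_eq_left ht0]

/-- **Jensen in time + Tonelli for the time-averaged window.** If `∫ Q_B(t)² dμ_T ≤ M` for all
`t ∈ (0, τ]` (`τ ≥ 0`), then `∫ (∫₀^τ Q_B(t)(x) dt)² dμ_T(x) ≤ τ · (τ M)`. [folklore] -/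
theorem integral_sq_intervalIntegral_window_le (γ : ℝ) (N k₁ k₂ : ℕ) {T : ℝ} (hT : 0 < T) {τ : ℝ}
    (hτ : 0 ≤ τ) {M : ℝ}
    (hM : ∀ t ∈ Ioc (0:ℝ) τ, ∫ x, (window ω₂ lam β γ N k₁ k₂ t x) ^ 2 ∂(gibbsWeight ω₂ lam β γ N T) ≤ M) :
    ∫ x, (∫ t in (0:ℝ)..τ, window ω₂ lam β γ N k₁ k₂ t x) ^ 2 ∂(gibbsWeight ω₂ lam β γ N T) ≤
      τ * (τ * M) := by
  haveI := isFiniteMeasure_gibbsWeight hω hl hβ γ N hT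
  set μ := gibbsWeight ω₂ lam β γ N T with hμ
  set Q : ℝ → PhaseSpace N → ℝ := fun t x => window ω₂ lam β γ N k₁ k₂ t x with hQ
  have hFm : Measurable fun p : ℝ × PhaseSpace N => (Q p.1 p.2) ^ 2 :=
    (measurable_window_uncurry hω hl hβ γ N k₁ k₂).pow_const 2
  have hslice : ∀ t, 0 ≤ t → Integrable (fun x => (Q t x) ^ 2) μ := fun t ht =>
    integrable_window_sq hω hl hβ N γ k₁ k₂ ht hT
  -- integrability on `(0, τ] × phase space`
  have hInt : Integrable (fun p : ℝ × PhaseSpace N => (Q p.1 p.2) ^ 2)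
      ((volume.restrict (Ioc (0 : ℝ) τ)).prod μ) := by
    rw [integrable_prod_iff hFm.aestronglyMeasurable]
    refine ⟨(ae_restrict_iff' measurableSet_Ioc).2 (Eventually.of_forall fun t ht => hslice t ht.1.le), ?_⟩
    have hmeas : AEStronglyMeasurable (fun t => ∫ x, ‖(Q t x) ^ 2‖ ∂μ) (volume.restrict (Ioc (0 : ℝ) τ)) :=
      (hFm.stronglyMeasurable.norm.integral_prod_right' (ν := μ)).aestronglyMeasurable
    refine (integrable_const M).mono' hmeas ?_
    refine (ae_restrict_iff' measurableSet_Ioc).2 (Eventually.of_forall fun t ht => ?_)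
    rw [Real.norm_eq_abs, abs_of_nonneg (integral_nonneg fun _ => norm_nonneg _)]
    refine le_trans (le_of_eq (integral_congr_ae (Eventually.of_forall fun x => ?_))) (hM t ht)
    simp only [Real.norm_eq_abs, abs_pow, sq_abs, hQ]
  -- pointwise Jensen (Cauchy–Schwarz in `t`)
  have hpt : ∀ x, (∫ t in (0:ℝ)..τ, Q t x) ^ 2 ≤ τ * ∫ t in Ioc (0:ℝ) τ, (Q t x) ^ 2 := fun x => by
    rw [intervalIntegral.integral_of_le hτ]
    exact CoboundaryCeiling.sq_setIntegral_Ioc_le hτ (continuous_window_time hω hl hβ γ N k₁ k₂ x)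
  have hI2 : Integrable (fun x => τ * ∫ t in Ioc (0:ℝ) τ, (Q t x) ^ 2) μ :=
    hInt.integral_prod_right.const_mul τ
  have hmono := integral_mono_of_nonneg (Eventually.of_forall fun x => sq_nonneg _) hI2 (Eventually.of_forall hpt)
  have hswap : ∫ x, (τ * ∫ t in Ioc (0:ℝ) τ, (Q t x) ^ 2) ∂μ = τ * ∫ t in Ioc (0:ℝ) τ, ∫ x, (Q t x) ^ 2 ∂μ := by
    rw [integral_const_mul, ← integral_integral_swap hInt]
  have hbound : ∫ t in Ioc (0:ℝ) τ, ∫ x, (Q t x) ^ 2 ∂μ ≤ τ * M := by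
    have hc : IntegrableOn (fun _ : ℝ => M) (Ioc (0:ℝ) τ) volume := integrable_const M
    calc ∫ t in Ioc (0:ℝ) τ, ∫ x, (Q t x) ^ 2 ∂μ ≤ ∫ t in Ioc (0:ℝ) τ, M :=
          setIntegral_mono_on hInt.integral_prod_left hc measurableSet_Ioc fun t ht => hM t ht
      _ = τ * M := by
          rw [setIntegral_const, Real.volume_real_Ioc_of_le hτ, sub_zero, smul_eq_mul]
  calc ∫ x, (∫ t in (0:ℝ)..τ, Q t x) ^ 2 ∂μ ≤ ∫ x, (τ * ∫ t in Ioc (0:ℝ) τ, (Q t x) ^ 2) ∂μ := hmono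
    _ = τ * ∫ t in Ioc (0:ℝ) τ, ∫ x, (Q t x) ^ 2 ∂μ := hswap
    _ ≤ τ * (τ * M) := mul_le_mul_of_nonneg_left hbound hτ

end Flow

/-! ## Registered form (crux vocabulary) -/

/-- **timeAverageJensenTonelli** (registered sub-goal of line `Sketch`, crux vocabulary): if the windowed transport
`Q_B(t)(x) = ∫_{(0,t]} J_B(Φ_s x) ds` has `∫ Q_B(t)² dμ_T ≤ M` for all `t ∈ (0, τ]` (`τ ≥ 0`), then its time
integral satisfies `∫ (∫₀^τ Q_B(t) dt)² dμ_T ≤ τ · (τ M)` (Jensen in `t`, Tonelli, slice bounds). [folklore] -/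
theorem timeAverageJensenTonelli : ∀ ω₂ lam β γ : ℝ, 0 < ω₂ → 0 ≤ lam → 0 ≤ β → ∀ T : ℝ, 0 < T → ∀ (N k₁ k₂ : ℕ) (τ M : ℝ), 0 ≤ τ → (∀ t ∈ Set.Ioc (0 : ℝ) τ, ∫ x, (∫ s in Set.Ioc (0 : ℝ) t, (∑ i : Fin N, (if k₁ ≤ i.val ∧ i.val < k₂ then (pinnedChain ω₂ lam β γ).bondCurrent N i (detFlow ω₂ lam β N s x) else 0))) ^ 2 ∂(volume.withDensity fun x : PhaseSpace N => ENNReal.ofReal (Real.exp (-((pinnedChain ω₂ lam β γ).hamiltonian N x) / T))) ≤ M) → ∫ x, (∫ t in (0 : ℝ)..τ, ∫ s in Set.Ioc (0 : ℝ) t, (∑ i : Fin N, (if k₁ ≤ i.val ∧ i.val < k₂ then (pinnedChain ω₂ lam β γ).bondCurrent N i (detFlow ω₂ lam β N s x) else 0))) ^ 2 ∂(volume.withDensity fun x : PhaseSpace N => ENNReal.ofReal (Real.exp (-((pinnedChain ω₂ lam β γ).hamiltonian N x) / T))) ≤ τ * (τ * M) := by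
  intro ω₂ lam β γ hω hl hβ T hT N k₁ k₂ τ M hτ hM
  exact integral_sq_intervalIntegral_window_le hω hl hβ γ N k₁ k₂ hT hτ hM


end Summit.AtomisticToContinuum.FouriersLaw.Theorems.SubBallisticWindow.TimeAveragedCorrector

end
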